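import Summits.HubbardSuperconductivity.HubbardSuperconductivity.Theorems.ThermalWedgeTwSeededEnsembleEquivalenceRColdSlicePackaging
import Summits.HubbardSuperconductivity.HubbardSuperconductivity.Theorems.ThermalWedgeTwSeededEnsembleEquivalenceRColdEdgeSweep
import Summits.HubbardSuperconductivity.HubbardSuperconductivity.Theorems.ThermalWedgeTwSeededEnsembleEquivalenceRNoSplitOfConcavity

/-!
# `TwSeededEnsembleEquivalenceR` from s-CONCAVITY of the cold sourced pressure + the two-phase core
# (crux stmt-HubbardSuperconductivity-15581, line `Sketch` v8.4; pool seat 0, alternative compositions)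

The lead's composition (skeleton v8.4, `Cruxes/TwSeededEnsembleEquivalenceR/Lines/Sketch.lean`) is
`twR_iff_coldSlice.mpr (stub_coldSlicePackaging stub_coldEdgeSweep NOSPLIT stub_twoPhaseCore)` with
`NOSPLIT := stub_noSplitGlue (stub_optimiserFloor hC) stub_sourcedColdUniqDeep`, i.e. it consumes the route item
`TwSourcedCondensation` (`hC`, stmt-1697, for the optimiser FLOOR) and the physics stub DEEP-UNIQ′ (unique optimal
source modulus among deep maximisers).

This file records the two WEAKER physics interfaces made available by the minimax glue
(`nsc_noSplit_of_concavity`, `nsc_noSplit_of_floor_of_deepConcavity`, landed p136124): NoSplit — and hence the crux,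
modulo the finite-dimensional two-phase core S7d — follows from plain (non-strict) concavity of
`s ↦ q(μ, √s)` for the cold sourced limit pressure `q`, with NO uniqueness, strictness or modulus:

* `twR_of_concavity_of_twoPhaseCore` : CONC on the whole squared box `[0, (13g+1)²]` + CORE ⟹ R — this closure does
  NOT use `TwSourcedCondensation` at all (no floor is needed when concavity holds down to `s = 0`);
* `twR_of_fvConcavity_of_twoPhaseCore` : the same from EVENTUAL FINITE-VOLUME concavity of
  `s ↦ log Z_L(e^{a/U}; dWaveSourceTorus L U μ √s)` (the shape a convergent expansion delivers);
* `twR_of_floor_deepConcavity_of_twoPhaseCore` : `hC` (FLOOR) + DEEP-CONC on the regulated range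
  `[e^{−a/(2U)}, (13g+1)²]` + CORE ⟹ R;
* `twR_of_floor_fvDeepConcavity_of_twoPhaseCore` : the same from eventual finite-volume deep concavity.

CORE is the registered signature of S7d `stub_twoPhaseCore` VERBATIM (lead c10, in progress); when it lands, each theorem
here specialises to a closure of R modulo ONE concavity statement. All other ingredients are landed theorems used by
name: `twR_iff_coldSlice` (…RColdSlice), `stub_coldSlicePackaging` (S7e, p141162), `stub_coldEdgeSweep` (S7a, p141703),
`stub_optimiserFloor` (p125780), `nsc_noSplit_of_concavity` / `nsc_noSplit_of_floor_of_deepConcavity` /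
`nsc_concavity_of_finiteVolume` / `nsc_deepConcavity_of_finiteVolume` (p136124).
-/

set_option linter.dupNamespace false

namespace Summit.HubbardSuperconductivity.HubbardSuperconductivity.Theorems

open Matrix Finset Literature.MathematicalPhysics.QuantumLattice
open Summit.HubbardSuperconductivity.HubbardSuperconductivity.Theses.ThermalWedge
open Summit.HubbardSuperconductivity.HubbardSuperconductivity.Theorems.TwSeededEnsembleEquivalenceR.ColdFloor
open Summit.HubbardSuperconductivity.HubbardSuperconductivity.Theorems.TwSeededEnsembleEquivalenceR.ColdFloorLine
open scoped ComplexOrder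

noncomputable section

/-- **CONC + CORE ⟹ R, with no use of `TwSourcedCondensation`.** First hypothesis (CONC): on every window
`[μ₁, μ₂] ⊂ (−4, 0)`, for some `a, K', U₀ > 0`, every pointwise limit `q` of the cold sourced torus pressure at
`β = e^{a/U}` has `s ↦ q(μ, √s)` concave on the whole squared source box `[0, (13g+1)²]` for interior `μ`. Second
hypothesis (CORE): the registered signature of S7d `stub_twoPhaseCore` verbatim. Composition: cold slice
(`twR_iff_coldSlice`) ∘ S7e packaging of {S7a edge sweep, NoSplit from CONC by the minimax glue, CORE}. [folklore composition] -/
theorem twR_of_concavity_of_twoPhaseCore :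
    (∀ (μ₁ μ₂ : ℝ), -4 < μ₁ → μ₁ < μ₂ → μ₂ < 0 → ∃ a K' U₀ : ℝ, 0 < a ∧ 0 < K' ∧ 0 < U₀ ∧
      ∀ U ∈ Set.Ioc (0 : ℝ) U₀, ∀ g ∈ Set.Icc (K' * U) (1 / 10), ∀ q : ℝ → ℝ → ℝ,
        (∀ μ ∈ Set.Icc μ₁ μ₂, ∀ h ∈ Set.Icc (-(13 * g + 1)) (13 * g + 1), ∀ κ : ℝ, 0 < κ →
            ∃ L₀ : ℕ, ∀ (L : ℕ) [NeZero L], L₀ ≤ L →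
              |Real.log (Matrix.partitionFn (Real.exp (a / U)) (dWaveSourceTorus L U μ h)).re /
                  (Real.exp (a / U) * (L : ℝ) ^ 2) - q μ h| ≤ κ) →
        ∀ μ ∈ Set.Ioo μ₁ μ₂,
          ConcaveOn ℝ (Set.Icc 0 ((13 * g + 1) ^ 2)) (fun s : ℝ => q μ (Real.sqrt s))) →
    (∀ (β U g δ μ₁ μ₂ μs h₀ : ℝ), 0 < β → 0 ≤ U → 0 < g → δ ∈ Set.Icc (1/10 : ℝ) (2/5 : ℝ) → μ₁ < μs → μs < μ₂ →
      h₀ ∈ Set.Icc (-(13 * g + 1)) (13 * g + 1) → ∀ q : ℝ → ℝ → ℝ,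
      (∀ μ ∈ Set.Icc μ₁ μ₂, ∀ h ∈ Set.Icc (-(13 * g + 1)) (13 * g + 1), ∀ κ : ℝ, 0 < κ →
        ∃ L₀ : ℕ, ∀ (L : ℕ) [NeZero L], L₀ ≤ L →
          |Real.log (Matrix.partitionFn β (dWaveSourceTorus L U μ h)).re / (β * (L : ℝ) ^ 2) - q μ h| ≤ κ) →
      q μs h₀ - h₀ ^ 2 / g = sSup ((fun h' : ℝ => q μs h' - h' ^ 2 / g) '' Set.Icc (-(13 * g + 1)) (13 * g + 1)) →
      (∀ μ' ∈ Set.Icc μ₁ μ₂, q μs h₀ + (1 - δ) * (μ' - μs) ≤ q μ' h₀) →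
      ∀ ε : ℝ, 0 < ε → ∃ L₀ : ℕ, ∀ (L : ℕ) [NeZero L], L₀ ≤ L →
        Real.log ((Matrix.partitionFn β (hubbardTorusWith 2 L 1 U μs - ((g / (L : ℝ) ^ 2 : ℝ) : ℂ) • ((pairField dWaveFormFactor L)ᴴ * pairField dWaveFormFactor L))).re /
            (∑ s ∈ (Finset.univ.filter fun s : Finset (Orb (FermionTorus 2 L)) => s.card = (2 * ⌊(1 - δ) * (L : ℝ) ^ 2 / 2⌋₊)), (Matrix.gibbsWeight β (hubbardTorusWith 2 L 1 U μs - ((g / (L : ℝ) ^ 2 : ℝ) : ℂ) • ((pairField dWaveFormFactor L)ᴴ * pairField dWaveFormFactor L)) s s).re)) ≤ β * ε * (L : ℝ) ^ 2) →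
    TwSeededEnsembleEquivalenceR :=
  fun hCONC hCore =>
    twR_iff_coldSlice.mpr
      (stub_coldSlicePackaging stub_coldEdgeSweep (nsc_noSplit_of_concavity hCONC) hCore)

/-- **FV-CONC + CORE ⟹ R, with no use of `TwSourcedCondensation`.** As `twR_of_concavity_of_twoPhaseCore`, with the
concavity hypothesis in its FINITE-VOLUME form: for interior `μ`, eventually in `L`, the finite-volume cold sourced
pressure `s ↦ log Z_L(e^{a/U}; dWaveSourceTorus L U μ √s) / (e^{a/U} L²)` is concave on `[0, (13g+1)²]`
(`nsc_concavity_of_finiteVolume` passes it to every pointwise limit). [folklore composition] -/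
theorem twR_of_fvConcavity_of_twoPhaseCore :
    (∀ (μ₁ μ₂ : ℝ), -4 < μ₁ → μ₁ < μ₂ → μ₂ < 0 → ∃ a K' U₀ : ℝ, 0 < a ∧ 0 < K' ∧ 0 < U₀ ∧
      ∀ U ∈ Set.Ioc (0 : ℝ) U₀, ∀ g ∈ Set.Icc (K' * U) (1 / 10), ∀ μ ∈ Set.Ioo μ₁ μ₂,
        ∃ L₀ : ℕ, ∀ (L : ℕ) [NeZero L], L₀ ≤ L →
          ConcaveOn ℝ (Set.Icc 0 ((13 * g + 1) ^ 2)) (fun s : ℝ =>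
            Real.log (Matrix.partitionFn (Real.exp (a / U)) (dWaveSourceTorus L U μ (Real.sqrt s))).re /
              (Real.exp (a / U) * (L : ℝ) ^ 2))) →
    (∀ (β U g δ μ₁ μ₂ μs h₀ : ℝ), 0 < β → 0 ≤ U → 0 < g → δ ∈ Set.Icc (1/10 : ℝ) (2/5 : ℝ) → μ₁ < μs → μs < μ₂ →
      h₀ ∈ Set.Icc (-(13 * g + 1)) (13 * g + 1) → ∀ q : ℝ → ℝ → ℝ,
      (∀ μ ∈ Set.Icc μ₁ μ₂, ∀ h ∈ Set.Icc (-(13 * g + 1)) (13 * g + 1), ∀ κ : ℝ, 0 < κ →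
        ∃ L₀ : ℕ, ∀ (L : ℕ) [NeZero L], L₀ ≤ L →
          |Real.log (Matrix.partitionFn β (dWaveSourceTorus L U μ h)).re / (β * (L : ℝ) ^ 2) - q μ h| ≤ κ) →
      q μs h₀ - h₀ ^ 2 / g = sSup ((fun h' : ℝ => q μs h' - h' ^ 2 / g) '' Set.Icc (-(13 * g + 1)) (13 * g + 1)) →
      (∀ μ' ∈ Set.Icc μ₁ μ₂, q μs h₀ + (1 - δ) * (μ' - μs) ≤ q μ' h₀) →
      ∀ ε : ℝ, 0 < ε → ∃ L₀ : ℕ, ∀ (L : ℕ) [NeZero L], L₀ ≤ L →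
        Real.log ((Matrix.partitionFn β (hubbardTorusWith 2 L 1 U μs - ((g / (L : ℝ) ^ 2 : ℝ) : ℂ) • ((pairField dWaveFormFactor L)ᴴ * pairField dWaveFormFactor L))).re /
            (∑ s ∈ (Finset.univ.filter fun s : Finset (Orb (FermionTorus 2 L)) => s.card = (2 * ⌊(1 - δ) * (L : ℝ) ^ 2 / 2⌋₊)), (Matrix.gibbsWeight β (hubbardTorusWith 2 L 1 U μs - ((g / (L : ℝ) ^ 2 : ℝ) : ℂ) • ((pairField dWaveFormFactor L)ᴴ * pairField dWaveFormFactor L)) s s).re)) ≤ β * ε * (L : ℝ) ^ 2) →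
    TwSeededEnsembleEquivalenceR :=
  fun hFV hCore => twR_of_concavity_of_twoPhaseCore (nsc_concavity_of_finiteVolume hFV) hCore

/-- **FLOOR (`TwSourcedCondensation`) + DEEP-CONC + CORE ⟹ R.** Here concavity of `s ↦ q(μ, √s)` is only assumed on
the regulated deep range `[e^{−a/(2U)}, (13g+1)²]`, for all small exponents `a ∈ (0, a₁]` (the quantifier shape of the
registered physics stub DEEP-UNIQ′ / DEEP-SCONC, but NON-strict); the optimiser floor `stub_optimiserFloor hC` (every
maximiser of the cold payoff is a deep source) supplies the rest through `nsc_noSplit_of_floor_of_deepConcavity`.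
[folklore composition] -/
theorem twR_of_floor_deepConcavity_of_twoPhaseCore :
    TwSourcedCondensation →
    (∀ (μ₁ μ₂ : ℝ), -4 < μ₁ → μ₁ < μ₂ → μ₂ < 0 → ∃ a₁ : ℝ, 0 < a₁ ∧ ∀ a ∈ Set.Ioc (0 : ℝ) a₁,
      ∃ K' U₀ : ℝ, 0 < K' ∧ 0 < U₀ ∧ ∀ U ∈ Set.Ioc (0 : ℝ) U₀, ∀ g ∈ Set.Icc (K' * U) (1 / 10),
        ∀ q : ℝ → ℝ → ℝ,
          (∀ μ ∈ Set.Icc μ₁ μ₂, ∀ h ∈ Set.Icc (-(13 * g + 1)) (13 * g + 1), ∀ κ : ℝ, 0 < κ →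
            ∃ L₀ : ℕ, ∀ (L : ℕ) [NeZero L], L₀ ≤ L →
              |Real.log (Matrix.partitionFn (Real.exp (a / U)) (dWaveSourceTorus L U μ h)).re /
                  (Real.exp (a / U) * (L : ℝ) ^ 2) - q μ h| ≤ κ) →
          ∀ μ ∈ Set.Ioo μ₁ μ₂,
            ConcaveOn ℝ (Set.Icc (Real.exp (-(a / (2 * U)))) ((13 * g + 1) ^ 2))
              (fun s : ℝ => q μ (Real.sqrt s))) →
    (∀ (β U g δ μ₁ μ₂ μs h₀ : ℝ), 0 < β → 0 ≤ U → 0 < g → δ ∈ Set.Icc (1/10 : ℝ) (2/5 : ℝ) → μ₁ < μs → μs < μ₂ →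
      h₀ ∈ Set.Icc (-(13 * g + 1)) (13 * g + 1) → ∀ q : ℝ → ℝ → ℝ,
      (∀ μ ∈ Set.Icc μ₁ μ₂, ∀ h ∈ Set.Icc (-(13 * g + 1)) (13 * g + 1), ∀ κ : ℝ, 0 < κ →
        ∃ L₀ : ℕ, ∀ (L : ℕ) [NeZero L], L₀ ≤ L →
          |Real.log (Matrix.partitionFn β (dWaveSourceTorus L U μ h)).re / (β * (L : ℝ) ^ 2) - q μ h| ≤ κ) →
      q μs h₀ - h₀ ^ 2 / g = sSup ((fun h' : ℝ => q μs h' - h' ^ 2 / g) '' Set.Icc (-(13 * g + 1)) (13 * g + 1)) →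
      (∀ μ' ∈ Set.Icc μ₁ μ₂, q μs h₀ + (1 - δ) * (μ' - μs) ≤ q μ' h₀) →
      ∀ ε : ℝ, 0 < ε → ∃ L₀ : ℕ, ∀ (L : ℕ) [NeZero L], L₀ ≤ L →
        Real.log ((Matrix.partitionFn β (hubbardTorusWith 2 L 1 U μs - ((g / (L : ℝ) ^ 2 : ℝ) : ℂ) • ((pairField dWaveFormFactor L)ᴴ * pairField dWaveFormFactor L))).re /
            (∑ s ∈ (Finset.univ.filter fun s : Finset (Orb (FermionTorus 2 L)) => s.card = (2 * ⌊(1 - δ) * (L : ℝ) ^ 2 / 2⌋₊)), (Matrix.gibbsWeight β (hubbardTorusWith 2 L 1 U μs - ((g / (L : ℝ) ^ 2 : ℝ) : ℂ) • ((pairField dWaveFormFactor L)ᴴ * pairField dWaveFormFactor L)) s s).re)) ≤ β * ε * (L : ℝ) ^ 2) →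
    TwSeededEnsembleEquivalenceR :=
  fun hC hDC hCore =>
    twR_iff_coldSlice.mpr
      (stub_coldSlicePackaging stub_coldEdgeSweep
        (nsc_noSplit_of_floor_of_deepConcavity (stub_optimiserFloor hC) hDC) hCore)

/-- **FLOOR (`TwSourcedCondensation`) + FV-DEEP-CONC + CORE ⟹ R.** As `twR_of_floor_deepConcavity_of_twoPhaseCore`,
with deep concavity in its finite-volume form (eventual concavity of the finite-volume cold sourced pressure in `s` on
the regulated range; `nsc_deepConcavity_of_finiteVolume`). [folklore composition] -/
theorem twR_of_floor_fvDeepConcavity_of_twoPhaseCore :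
    TwSourcedCondensation →
    (∀ (μ₁ μ₂ : ℝ), -4 < μ₁ → μ₁ < μ₂ → μ₂ < 0 → ∃ a₁ : ℝ, 0 < a₁ ∧ ∀ a ∈ Set.Ioc (0 : ℝ) a₁,
      ∃ K' U₀ : ℝ, 0 < K' ∧ 0 < U₀ ∧ ∀ U ∈ Set.Ioc (0 : ℝ) U₀, ∀ g ∈ Set.Icc (K' * U) (1 / 10),
        ∀ μ ∈ Set.Ioo μ₁ μ₂, ∃ L₀ : ℕ, ∀ (L : ℕ) [NeZero L], L₀ ≤ L →
          ConcaveOn ℝ (Set.Icc (Real.exp (-(a / (2 * U)))) ((13 * g + 1) ^ 2)) (fun s : ℝ =>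
            Real.log (Matrix.partitionFn (Real.exp (a / U)) (dWaveSourceTorus L U μ (Real.sqrt s))).re /
              (Real.exp (a / U) * (L : ℝ) ^ 2))) →
    (∀ (β U g δ μ₁ μ₂ μs h₀ : ℝ), 0 < β → 0 ≤ U → 0 < g → δ ∈ Set.Icc (1/10 : ℝ) (2/5 : ℝ) → μ₁ < μs → μs < μ₂ →
      h₀ ∈ Set.Icc (-(13 * g + 1)) (13 * g + 1) → ∀ q : ℝ → ℝ → ℝ,
      (∀ μ ∈ Set.Icc μ₁ μ₂, ∀ h ∈ Set.Icc (-(13 * g + 1)) (13 * g + 1), ∀ κ : ℝ, 0 < κ →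
        ∃ L₀ : ℕ, ∀ (L : ℕ) [NeZero L], L₀ ≤ L →
          |Real.log (Matrix.partitionFn β (dWaveSourceTorus L U μ h)).re / (β * (L : ℝ) ^ 2) - q μ h| ≤ κ) →
      q μs h₀ - h₀ ^ 2 / g = sSup ((fun h' : ℝ => q μs h' - h' ^ 2 / g) '' Set.Icc (-(13 * g + 1)) (13 * g + 1)) →
      (∀ μ' ∈ Set.Icc μ₁ μ₂, q μs h₀ + (1 - δ) * (μ' - μs) ≤ q μ' h₀) →
      ∀ ε : ℝ, 0 < ε → ∃ L₀ : ℕ, ∀ (L : ℕ) [NeZero L], L₀ ≤ L →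
        Real.log ((Matrix.partitionFn β (hubbardTorusWith 2 L 1 U μs - ((g / (L : ℝ) ^ 2 : ℝ) : ℂ) • ((pairField dWaveFormFactor L)ᴴ * pairField dWaveFormFactor L))).re /
            (∑ s ∈ (Finset.univ.filter fun s : Finset (Orb (FermionTorus 2 L)) => s.card = (2 * ⌊(1 - δ) * (L : ℝ) ^ 2 / 2⌋₊)), (Matrix.gibbsWeight β (hubbardTorusWith 2 L 1 U μs - ((g / (L : ℝ) ^ 2 : ℝ) : ℂ) • ((pairField dWaveFormFactor L)ᴴ * pairField dWaveFormFactor L)) s s).re)) ≤ β * ε * (L : ℝ) ^ 2) →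
    TwSeededEnsembleEquivalenceR :=
  fun hC hFVD hCore =>
    twR_of_floor_deepConcavity_of_twoPhaseCore hC (nsc_deepConcavity_of_finiteVolume hFVD) hCore

end

end Summit.HubbardSuperconductivity.HubbardSuperconductivity.Theorems
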